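import Summits.QuantumFields.BalabanUV.T4Continuum.Support.B13OutKPFormRecord
import Summits.QuantumFields.BalabanUV.T4Continuum.Support.ActivityStepJunction

/-!
# NE5 ∕ U3, route P2 — THE KOTECKÝ–PREISS-FORM STEP MODEL OF RECORD: route P2's MI-R (`Represents` ∧ `Realizes` ∧ `ReadsStep`)
# BY CONSTRUCTION on Bałaban's carriers of record, its outputs EQUAL to the holder lineage's outputs of record on the convergence
# window (R-IDENT), and route P2's END-L (`T4ActivityThreshold`) applied to it — the activity route's END ON THE FUNCTIONALS OF RECORD

Cell `pub-balaban`, unit `b2b-balaban-t4-ne5-p2` (T⁴ fan-out NE5 ∕ node U3, PROVER seat P2 «polymer-activity Lipschitz ∕ Kotecký–Preiss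
route», lineage gen 18).  Summits-side new work under the LEAN PLACEMENT RULE (cell bookkeeping over the swarm's objects of record; NOT a
Literature module; nothing of the manuscripts under audit is asserted).  HONEST FRAMING: rung (B)+1 of the FINITE-VOLUME T⁴ continuum
programme — NOT infinite volume, NOT a mass gap, NOT the Clay problem, and **NOT A PROOF OF NE5** (spine 0∕9): the END below is an
IMPLICATION whose analytic binders (the (2.38)-shaped majorant and the two inequalities of L03, the activity majorant and the two-species
activity modulus L07 of the activities OF RECORD, the levels, W1 in the holder's currency, W4, W3, numerics) are DISPLAYED.  HONEST
DEPENDENCY (cell line, verbatim): continuum YM on T⁴ ⇐ BetaPertH ∧ nine spine estimates (0/9 proved); BetaPertH ⇐ (D1) ∧ (D4) ∧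
CAP+tail; G-an2-4 gates asym, D1 and NE2/3/4.

WHAT.  For the slots `S : B13StepOfRecord.Slots R E IOp Hist` of the model of record and levels `E₀`, `cB`:
* §1 **`kpStep S E₀ cB`** — the step model of record with its output functional REPLACED by route P2's Kotecký–Preiss form
  `Σ_{K ∈ clus X} Φᵀ_{G.inc}(K; H_k(o,h))`, `H_k(o,h) Z = Σ_{ℓ ∈ innerLabels k Z} S.act Z ℓ o h` (same operator data, insertions, base,
  margins); its outputs **`outA_KP`∕`outB_KP`** DEFINED by the causal recursion (`StepRecursion.recA`∕`recB`), `RepresentsA`∕`RepresentsB`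
  by construction (run A under the holder's transport reading);
* §2 the ACTIVITY FAMILIES OF RECORD `rhoA`∕`rhoB` (the activity read at each run's own input point of the KP recursion) and
  **`represents_kp`**: `(B13DomainGeometryTR.clusterRep R rhoA rhoB).Represents outA_KP outB_KP` (L01 for route P2 ON BAŁABAN's CARRIERS,
  no hypothesis beyond the transport reading); the INPUT MODEL OF RECORD `inputModel S E₀ cB := InputModel.ofStep …` with
  **`realizes_kp`** (L02, no hypothesis) and **`readsStep_kp`** (`ReadsStep inputModel (step S E₀ cB)` — the holder's W1∕W3∕W4 binders
  feed route P2 verbatim);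
* §3 **`outB_KP_eq_outB`** ∕ **`outA_KP_eq_outA`** (R-IDENT, part C, + the holder's uniqueness `eq_outB`∕`eq_outA`): on a window where the
  two convergence binders hold at the KP recursion's input points, `outB_KP = B13StepOfRecord.outB S E₀ cB` (and run A at
  transported backgrounds) — ONE pair of functionals of record for both routes;
* §4 **`ne5_above_max_kp_record`** — route P2's END-L `T4ActivityThreshold.ne5_above_max_of_model_actLip₂_reach` ON THE OBJECTS OF
  RECORD: MI-R DISCHARGED (§2), L08a∕L08b PROVED (`decayExtract_b13`∕`pinBudget_b13`), L03 = `kpInflated_b13` (majorant + two inequalities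
  displayed), the structure binders of the insertions PROVED (holder's `structure_binders`), everything else DISPLAYED in the holder's
  own currency through `readsStep_kp`; conclusion `∃ C₅, NE5 (outA_KP S E₀ cB) (outB_KP S E₀ cB) W κ θ′ C₅`, and — with §3 —
  **`ne5_above_max_record_of_kp`**: the SAME for the holder's `(outA, outB)`.
0 sorry; axioms ⊆ {propext, Classical.choice, Quot.sound}.
-/

noncomputable section

open scoped BigOperators

namespace Summit.QuantumFields.BalabanUV.T4Continuum.B13KPStepOfRecord

open Literature.MathematicalPhysics.QuantumFieldTheory.Balaban1983to89
open Literature.MathematicalPhysics.QuantumFieldTheory.Balaban1983to89.T4OutputRate (Carriers Functional DecayBound NE5)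
open Literature.MathematicalPhysics.QuantumFieldTheory.Balaban1983to89.T4InputCauchyRateData (StepModel tableA tableB)
open Literature.MathematicalPhysics.QuantumFieldTheory.Balaban1983to89.T4ActivityRecursion (InputModel KPInflated)
open Literature.MathematicalPhysics.QuantumFieldTheory.Balaban1983to89.T4ActivityThreshold (ne5_above_max_of_model_actLip₂_reach)
open Literature.Probability.LatticeModels (truncatedWeight truncatedWeight_congr)
open Summit.QuantumFields.BalabanUV.T4Continuum.B13Carriers (TwoRuns)
open Summit.QuantumFields.BalabanUV.T4Continuum.ClusterRepOfDomains (DomainGeometry)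
open Summit.QuantumFields.BalabanUV.T4Continuum.B13DomainGeometryTR (domainGeometry clusterRep footprint decayExtract_b13
  pinBudget_b13 kpInflated_b13)
open Summit.QuantumFields.BalabanUV.T4Continuum.B13InnerData (b13InnerData Bnd)
open Summit.QuantumFields.BalabanUV.T4Continuum.B13OpDatum (OpDatum)
open Summit.QuantumFields.BalabanUV.T4Continuum.B13StepOfRecord (Slots step outA outB assembly step_Out eq_outB eq_outA
  structure_binders)
open Summit.QuantumFields.BalabanUV.T4Continuum.B13StepTermLabels (InnerLabel termLabels)
open Summit.QuantumFields.BalabanUV.T4Continuum.B13StepTermSocket (touchInc labelsIndexing)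
open Summit.QuantumFields.BalabanUV.T4Continuum.B13StepTermFamily (term out)
open Summit.QuantumFields.BalabanUV.T4Continuum.B13OutKPForm (activity out_eq_clusterSum_inc)
open Summit.QuantumFields.BalabanUV.T4Continuum.B13OutKPFormRecord (actOf LevelSummable ClusAbsConv)
open Summit.QuantumFields.BalabanUV.T4Continuum.StepRecursion (InsBlindB ReadsTransported recA recB representsA_recA
  representsB_recB)
open Summit.QuantumFields.BalabanUV.T4Continuum.ActivityStepJunction (ReadsStep readsStep_ofStep)
open Summit.QuantumFields.BalabanUV.T4Continuum.UrsellMayerSeries (UKabs)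

variable {G : Type} [GaugeGroup G] {R : TwoRuns G} {E IOp Hist : Type*} [NormedAddCommGroup Hist] [NormedSpace ℂ Hist]
  (S : Slots R E IOp Hist) (E₀ cB : ℝ)

/-! ## §1 The Kotecký–Preiss-form step model of record and its outputs by the causal recursion -/

/-- [folklore] **THE KP-FORM STEP MODEL OF RECORD**: the step model of record `B13StepOfRecord.step S E₀ cB` with its output REPLACED
by route P2's Kotecký–Preiss cluster sum of the activities — `Out k o h X := Σ_{K ∈ clus X} Φᵀ_{G.inc}(K; Z ↦ Σ_{ℓ ∈ innerLabels k Z}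
S.act Z ℓ o h)` — and the SAME operator data, insertions, base and margins. -/
def kpStep : StepModel R.carriers (OpDatum E) Hist :=
  { step S E₀ cB with
    Out := fun k o h X => ∑ K ∈ (domainGeometry R).clus X,
      truncatedWeight (domainGeometry R).inc (activity (b13InnerData R) S.act k o h) K }

/-- [folklore] The KP-form output unfolded. -/
theorem kpStep_Out (k : ℕ) (o : OpDatum E) (h : Hist) (X : R.carriers.Dom) :
    (kpStep S E₀ cB).Out k o h X =
      ∑ K ∈ (domainGeometry R).clus X, truncatedWeight (domainGeometry R).inc (activity (b13InnerData R) S.act k o h) K := rfl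

/-- [folklore] The data fields are those of the step of record (`rfl`). -/
theorem kpStep_opA : (kpStep S E₀ cB).opA = (step S E₀ cB).opA := rfl
/-- [folklore] -/
theorem kpStep_opB : (kpStep S E₀ cB).opB = (step S E₀ cB).opB := rfl
/-- [folklore] -/
theorem kpStep_insA : (kpStep S E₀ cB).insA = (step S E₀ cB).insA := rfl
/-- [folklore] -/
theorem kpStep_insB : (kpStep S E₀ cB).insB = (step S E₀ cB).insB := rfl
/-- [folklore] -/
theorem kpStep_Base : (kpStep S E₀ cB).Base = (step S E₀ cB).Base := rfl
/-- [folklore] -/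
theorem kpStep_rOp : (kpStep S E₀ cB).rOp = (step S E₀ cB).rOp := rfl
/-- [folklore] -/
theorem kpStep_rHist : (kpStep S E₀ cB).rHist = (step S E₀ cB).rHist := rfl

/-- [folklore] Run B's blindness for the KP-form model (same insertion as the step of record). -/
theorem insBlindB_kp (W : Set (ℕ → ℝ)) : InsBlindB (kpStep S E₀ cB) W := by
  intro k g hg U t t' htt'
  rw [kpStep_insB]
  exact (structure_binders S E₀ cB W).2.2.2 k g hg U t t' htt'

/-- [folklore] Run A's blindness for the KP-form model. -/
theorem insBlind_kp (W : Set (ℕ → ℝ)) : (kpStep S E₀ cB).InsBlind W := by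
  intro k g hg U t t' htt'
  rw [kpStep_insA]
  exact (structure_binders S E₀ cB W).2.1 k g hg U t t' htt'

/-- [folklore] Run A's data of the KP-form model are read at the transported background (the holder's transport reading). -/
theorem readsTransported_kp {W : Set (ℕ → ℝ)} (hT : (assembly S).TransportReads W) : ReadsTransported (kpStep S E₀ cB) W := by
  intro g hg U U' hUU'
  rw [kpStep_opA, kpStep_insA]
  exact (assembly S).readsTransported ((assembly S).bHist E₀ cB) hT g hg U U' hUU'

/-- [folklore] **RUN B's OUTPUT OF THE KP-FORM MODEL**, defined by the causal recursion. -/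
def outB_KP : Functional R.carriers R.carriers.BgB := recB (kpStep S E₀ cB)

/-- [folklore] **RUN A's OUTPUT OF THE KP-FORM MODEL**, defined by the causal recursion at transported backgrounds. -/
def outA_KP : Functional R.carriers R.carriers.BgA := recA (kpStep S E₀ cB)

/-- [folklore] `RepresentsB` for the KP-form model, hypothesis-free. -/
theorem representsB_kp (W : Set (ℕ → ℝ)) : (kpStep S E₀ cB).RepresentsB (outB_KP S E₀ cB) W :=
  representsB_recB (insBlindB_kp S E₀ cB W)

/-- [folklore] `RepresentsA` for the KP-form model under the transport reading. -/
theorem representsA_kp {W : Set (ℕ → ℝ)} (hT : (assembly S).TransportReads W) :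
    (kpStep S E₀ cB).RepresentsA (outA_KP S E₀ cB) W :=
  representsA_recA (insBlind_kp S E₀ cB W) (readsTransported_kp S E₀ cB hT)

/-! ## §2 The activity families of record; route P2's `Represents`, `Realizes`, `ReadsStep` BY CONSTRUCTION -/

/-- [folklore] Run B's input point of the KP recursion at `(g, U, X)`. -/
def inputB_KP (g : ℕ → ℝ) (U : R.carriers.BgB) (X : R.carriers.Dom) : OpDatum E × Hist :=
  ((step S E₀ cB).opB g U (R.carriers.scale X),
    (step S E₀ cB).insB g U (R.carriers.scale X) (tableB (outB_KP S E₀ cB) g U))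

/-- [folklore] Run A's input point of the KP recursion at `(g, U, X)`. -/
def inputA_KP (g : ℕ → ℝ) (U : R.carriers.BgB) (X : R.carriers.Dom) : OpDatum E × Hist :=
  ((step S E₀ cB).opA g U (R.carriers.scale X),
    (step S E₀ cB).insA g U (R.carriers.scale X) (tableA (outA_KP S E₀ cB) g U))

/-- [folklore] **RUN B's ACTIVITY FAMILY OF RECORD**: the activity of the polymer `Z` read at run B's own input point of ITS step. -/
def rhoB : (ℕ → ℝ) → R.carriers.BgB → R.carriers.Dom → ℂ := fun g U Z =>
  activity (b13InnerData R) S.act (R.carriers.scale Z) ((step S E₀ cB).opB g U (R.carriers.scale Z))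
    ((step S E₀ cB).insB g U (R.carriers.scale Z) (tableB (outB_KP S E₀ cB) g U)) Z

/-- [folklore] **RUN A's ACTIVITY FAMILY OF RECORD** (transported input). -/
def rhoA : (ℕ → ℝ) → R.carriers.BgB → R.carriers.Dom → ℂ := fun g U Z =>
  activity (b13InnerData R) S.act (R.carriers.scale Z) ((step S E₀ cB).opA g U (R.carriers.scale Z))
    ((step S E₀ cB).insA g U (R.carriers.scale Z) (tableA (outA_KP S E₀ cB) g U)) Z

/-- [folklore] On the step catalogue of `X` the activity family of record IS the activity read at `X`'s input point (same scale). -/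
theorem rhoB_eq_of_mem {g : ℕ → ℝ} {U : R.carriers.BgB} {X Z : R.carriers.Dom}
    (hZ : Z ∈ (domainGeometry R).level (R.carriers.scale X)) :
    rhoB S E₀ cB g U Z = activity (b13InnerData R) S.act (R.carriers.scale X) ((step S E₀ cB).opB g U (R.carriers.scale X))
      ((step S E₀ cB).insB g U (R.carriers.scale X) (tableB (outB_KP S E₀ cB) g U)) Z := by
  have hsc : R.carriers.scale Z = R.carriers.scale X := ((domainGeometry R).mem_level Z _).1 hZ
  unfold rhoB
  rw [hsc]

/-- [folklore] (run A) -/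
theorem rhoA_eq_of_mem {g : ℕ → ℝ} {U : R.carriers.BgB} {X Z : R.carriers.Dom}
    (hZ : Z ∈ (domainGeometry R).level (R.carriers.scale X)) :
    rhoA S E₀ cB g U Z = activity (b13InnerData R) S.act (R.carriers.scale X) ((step S E₀ cB).opA g U (R.carriers.scale X))
      ((step S E₀ cB).insA g U (R.carriers.scale X) (tableA (outA_KP S E₀ cB) g U)) Z := by
  have hsc : R.carriers.scale Z = R.carriers.scale X := ((domainGeometry R).mem_level Z _).1 hZ
  unfold rhoA
  rw [hsc]

/-- [folklore] The KP-form output at an input of `X` is route P2's cluster sum over any activity family agreeing with the activity on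
the step catalogue. -/
theorem kpStep_Out_eq_clusterSum {X : R.carriers.Dom} (o : OpDatum E) (h : Hist) {ρ : R.carriers.Dom → ℂ}
    (hρ : ∀ Z ∈ (domainGeometry R).level (R.carriers.scale X), ρ Z = activity (b13InnerData R) S.act (R.carriers.scale X) o h Z) :
    (kpStep S E₀ cB).Out (R.carriers.scale X) o h X =
      ∑ K ∈ (domainGeometry R).clus X, truncatedWeight (domainGeometry R).inc ρ K := by
  rw [kpStep_Out]
  refine Finset.sum_congr rfl fun K hK => truncatedWeight_congr fun Z hZ => ?_
  exact (hρ Z (((DomainGeometry.mem_clus (domainGeometry R)).1 hK).1 hZ)).symm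

/-- [folklore] **L01 FOR ROUTE P2 ON BAŁABAN's CARRIERS, BY CONSTRUCTION**: `Represents` for the cluster representation of record with
the activity families of record and the outputs of the KP recursion (run A needs the transport reading on every coupling sequence, as
`Represents` has no window). -/
theorem represents_kp (hT : (assembly S).TransportReads Set.univ) :
    (clusterRep R (rhoA S E₀ cB) (rhoB S E₀ cB)).Represents (outA_KP S E₀ cB) (outB_KP S E₀ cB) := by
  refine ⟨fun g U X => ?_, fun g U X => ?_⟩
  · rw [representsA_kp S E₀ cB hT g (Set.mem_univ g) U X, kpStep_opA, kpStep_insA,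
      kpStep_Out_eq_clusterSum S E₀ cB _ _ (fun Z hZ => rhoA_eq_of_mem S E₀ cB hZ)]
    rfl
  · rw [representsB_kp S E₀ cB Set.univ g (Set.mem_univ g) U X, kpStep_opB, kpStep_insB,
      kpStep_Out_eq_clusterSum S E₀ cB _ _ (fun Z hZ => rhoB_eq_of_mem S E₀ cB hZ)]
    rfl

/-- [folklore] **THE INPUT MODEL OF RECORD for route P2** (`ActivityStepJunction.InputModel.ofStep`): activities = the activity of
record as a function of the two-species input, operator data ∕ insertions ∕ margins ∕ base READ from the step of record. -/
def inputModel : InputModel (clusterRep R (rhoA S E₀ cB) (rhoB S E₀ cB)) (OpDatum E) Hist :=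
  ActivityStepJunction.InputModel.ofStep (step S E₀ cB) (fun _ _ X Z q => actOf S X q Z) fun g U X =>
    (step S E₀ cB).Base (R.carriers.scale X) g U

/-- [folklore] **`ReadsStep` BY CONSTRUCTION** against the STEP OF RECORD (so the holder's W1∕W3∕W4 binders feed route P2 verbatim). -/
theorem readsStep_kp : ReadsStep (inputModel S E₀ cB) (step S E₀ cB) := readsStep_ofStep _ _ _

/-- [folklore] **L02 FOR ROUTE P2 ON BAŁABAN's CARRIERS, BY CONSTRUCTION**: `Realizes` — the activity families of record ARE the
values of the input model's activity at the two runs' own input points (no hypothesis). -/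
theorem realizes_kp (W : Set (ℕ → ℝ)) : (inputModel S E₀ cB).Realizes (outA_KP S E₀ cB) (outB_KP S E₀ cB) W := by
  intro g _ U X Z hZ
  constructor
  · show activity (b13InnerData R) S.act (R.carriers.scale X) ((step S E₀ cB).opB g U (R.carriers.scale X))
      ((step S E₀ cB).insB g U (R.carriers.scale X) (tableB (outB_KP S E₀ cB) g U)) Z = rhoB S E₀ cB g U Z
    exact (rhoB_eq_of_mem S E₀ cB hZ).symm
  · show activity (b13InnerData R) S.act (R.carriers.scale X) ((step S E₀ cB).opA g U (R.carriers.scale X))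
      ((step S E₀ cB).insA g U (R.carriers.scale X) (tableA (outA_KP S E₀ cB) g U)) Z = rhoA S E₀ cB g U Z
    exact (rhoA_eq_of_mem S E₀ cB hZ).symm

/-- [folklore] `InBase` for route P2's input model of record IS the step of record's `InBase` for the KP outputs. -/
theorem inBase_kp {W : Set (ℕ → ℝ)} (h : (step S E₀ cB).InBase (outB_KP S E₀ cB) W) :
    (inputModel S E₀ cB).InBase (outB_KP S E₀ cB) W :=
  (readsStep_kp S E₀ cB).inBase (fun _ _ _ => rfl) h

/-! ## §3 R-IDENT: the KP recursion's outputs ARE the outputs of record on the convergence window -/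

/-- [folklore] **`outB_KP = outB` ON THE WINDOW** where part (C)'s two convergence binders hold at the KP recursion's input points: there the
KP-form output is the ordered output of record (`B13OutKPForm.out_eq_clusterSum_inc`), so `outB_KP` satisfies the holder's `RepresentsB`,
whose solution is unique (`B13StepOfRecord.eq_outB`). -/
theorem outB_KP_eq_outB {W : Set (ℕ → ℝ)}
    (hsum : ∀ g ∈ W, ∀ (U : R.carriers.BgB) (X : R.carriers.Dom), LevelSummable S X (inputB_KP S E₀ cB g U X))
    (hK : ∀ g ∈ W, ∀ (U : R.carriers.BgB) (X : R.carriers.Dom), ClusAbsConv S X (inputB_KP S E₀ cB g U X))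
    {g : ℕ → ℝ} (hg : g ∈ W) (U : R.carriers.BgB) (X : R.carriers.Dom) :
    outB_KP S E₀ cB g U X = outB S E₀ cB g U X := by
  refine eq_outB S E₀ cB (W := W) (fun g' hg' U' X' => ?_) hg U X
  rw [representsB_kp S E₀ cB W g' hg' U' X', kpStep_opB, kpStep_insB, kpStep_Out, step_Out]
  exact congrArg Complex.re (out_eq_clusterSum_inc (domainGeometry R) (b13InnerData R) S.act rfl
    (inputB_KP S E₀ cB g' U' X').1 (inputB_KP S E₀ cB g' U' X').2 (hsum g' hg' U' X') (hK g' hg' U' X')).symm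

/-- [folklore] **`outA_KP = outA` ON THE WINDOW** (at transported backgrounds), under the transport reading and the binders at run A's
input points of the KP recursion. -/
theorem outA_KP_eq_outA {W : Set (ℕ → ℝ)} (hT : (assembly S).TransportReads W)
    (hsum : ∀ g ∈ W, ∀ (U : R.carriers.BgB) (X : R.carriers.Dom), LevelSummable S X (inputA_KP S E₀ cB g U X))
    (hK : ∀ g ∈ W, ∀ (U : R.carriers.BgB) (X : R.carriers.Dom), ClusAbsConv S X (inputA_KP S E₀ cB g U X))
    {g : ℕ → ℝ} (hg : g ∈ W) (U : R.carriers.BgB) (X : R.carriers.Dom) :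
    outA_KP S E₀ cB g (R.carriers.transport U) X = outA S E₀ cB g (R.carriers.transport U) X := by
  refine eq_outA S E₀ cB hT (W := W) (fun g' hg' U' X' => ?_) hg U X
  rw [representsA_kp S E₀ cB hT g' hg' U' X', kpStep_opA, kpStep_insA, kpStep_Out, step_Out]
  exact congrArg Complex.re (out_eq_clusterSum_inc (domainGeometry R) (b13InnerData R) S.act rfl
    (inputA_KP S E₀ cB g' U' X').1 (inputA_KP S E₀ cB g' U' X').2 (hsum g' hg' U' X') (hK g' hg' U' X')).symm

/-! ## §4 Route P2's END-L on the objects of record -/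

/-- [folklore] **ROUTE P2's END-L ON BAŁABAN's CARRIERS OF RECORD, FOR THE KP RECURSION's OUTPUTS.**  `T4ActivityThreshold.
ne5_above_max_of_model_actLip₂_reach` for the input model of record: MI-R (`Represents`, `Realizes`) DISCHARGED by §2, L08a∕L08b PROVED
(`decayExtract_b13`∕`pinBudget_b13`), L03 = `kpInflated_b13` (the (2.38)-shaped majorant `m ≤ A_m·e^{−R_m·d}` on every 𝐃_k and the two
inequalities DISPLAYED), the insertion structure PROVED (holder's `structure_binders`), and — DISPLAYED in the HOLDER's currency through
`readsStep_kp` — the base membership, the activity majorant `BaseMajorant`, the two-species activity modulus `ActivityLipschitz₂` (L07 for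
the activities of record; the target of `B13TermOpSecant`-type termwise producers), the levels, W1 `OperatorRate`, W4 `InsertionRate`, W3
`InsScaleBound`, numerics.  Conclusion `∃ C₅, NE5 (outA_KP S E₀ cB) (outB_KP S E₀ cB) W κ θ′ C₅`.  NOT a proof of NE5. -/
theorem ne5_above_max_kp_record (hT : (assembly S).TransportReads Set.univ) {W : Set (ℕ → ℝ)}
    {m : (ℕ → ℝ) → R.carriers.BgB → R.carriers.Dom → ℝ}
    {A_m R_m τ σ s A₀ E₀' E₁ κ θ δ δ' c ω Λop Λhist ρ₀ ρ₀' : ℝ}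
    -- L03 in letters: the (2.38)-shaped majorant and the two explicit inequalities
    (hA_m : 0 ≤ A_m) (hτ : 0 ≤ τ) (hσ : 0 ≤ σ) (hs0 : 0 ≤ s)
    (hm0 : ∀ (g : ℕ → ℝ) (U : R.carriers.BgB) (Z : R.carriers.Dom), 0 ≤ m g U Z)
    (hm : ∀ g ∈ W, ∀ (U : R.carriers.BgB) (k : ℕ), ∀ Z ∈ R.domAt k, m g U Z ≤ A_m * Real.exp (-(R_m * R.carriers.d Z)))
    (hrate : 64 * Real.log 162 + σ + τ * 64 ≤ R_m)
    (hsmall : (1 + s) * A_m * Real.exp (σ * 5 + τ * 64) * B12TreeDecay.K₀ (4 * 2 ^ 4) (2 * 4) * 9 ≤ τ) (hσκ : κ + 1 ≤ σ)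
    -- base membership, the activity majorant and the two-species activity modulus of the activities OF RECORD
    (hbase : (step S E₀ cB).InBase (outB_KP S E₀ cB) W)
    (hmaj : (inputModel S E₀ cB).BaseMajorant W m) (hlip : (inputModel S E₀ cB).ActivityLipschitz₂ W m Λop Λhist ρ₀)
    -- levels, W1, W4, W3 in the holder's currency
    (hdA : DecayBound (outA_KP S E₀ cB) W A₀ κ) (hdB : DecayBound (outB_KP S E₀ cB) W E₀' κ)
    (hop : (step S E₀ cB).OperatorRate W δ θ) (hins : (step S E₀ cB).InsertionRate W κ E₀' δ' θ)
    (hunit : (step S E₀ cB).InsScaleBound W κ E₁ c ω)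
    -- numerics
    (hE₁ : 0 < E₁) (hΛop : 0 < Λop) (hΛhist : 0 < Λhist) (hρ : max (Λhist / Λop) 1 * ρ₀' ≤ ρ₀)
    (hs : Λhist * ρ₀' < s) (hδ : 0 ≤ δ) (hδ' : 0 ≤ δ') (hθ : 0 ≤ θ) (hθ1 : θ < 1)
    (hc : 0 ≤ c) (hω : 0 < ω) (hω1 : ω < 1) (hreach : c * (A₀ + E₀') / (1 - ω) < ρ₀')
    {θ' : ℝ} (hθ' : max θ (ω + (τ * 64 * Real.exp (-(σ * 5))) * Λhist / (s - Λhist * ρ₀') * c) < θ') :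
    ∃ C₅, NE5 (outA_KP S E₀ cB) (outB_KP S E₀ cB) W κ θ' C₅ := by
  have hR := readsStep_kp S E₀ cB
  obtain ⟨haffN, hblindN, hhomN, -⟩ := structure_binders S E₀ cB W
  exact ne5_above_max_of_model_actLip₂_reach (inputModel S E₀ cB) (represents_kp S E₀ cB hT) (realizes_kp S E₀ cB W)
    (inBase_kp S E₀ cB hbase) hmaj (kpInflated_b13 (rhoA S E₀ cB) (rhoB S E₀ cB) hA_m hτ hσ hs0 hm0 hm hrate hsmall) hlip
    (decayExtract_b13 (rhoA S E₀ cB) (rhoB S E₀ cB) hσ) (pinBudget_b13 (rhoA S E₀ cB) (rhoB S E₀ cB) hτ hσκ) hdA hdB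
    (hR.operatorRate hop) (hR.insertionRate hins) (hR.insAffine haffN) (hR.insBlind hblindN) (hR.insHomog hhomN)
    (hR.insScaleBound hunit) hE₁ (by positivity) hΛop hΛhist hρ hs hδ hδ' hθ hθ1 hc hω hω1 hreach hθ'

/-- [folklore] **ROUTE P2's END ON THE HOLDER's FUNCTIONALS OF RECORD** (`B13StepOfRecord.outA`∕`outB`): the END above transferred by
R-IDENT (§3) — on a window where the two convergence binders hold at both runs' input points of the KP recursion, the KP outputs ARE the
outputs of record, so `∃ C₅, NE5 (outA S E₀ cB) (outB S E₀ cB) W κ θ′ C₅` under the same displayed binders.  The two NE5 routes end on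
ONE pair of functionals.  NOT a proof of NE5. -/
theorem ne5_above_max_record_of_kp (hT : (assembly S).TransportReads Set.univ) {W : Set (ℕ → ℝ)} {κ θ' : ℝ}
    (hsumA : ∀ g ∈ W, ∀ (U : R.carriers.BgB) (X : R.carriers.Dom), LevelSummable S X (inputA_KP S E₀ cB g U X))
    (hKA : ∀ g ∈ W, ∀ (U : R.carriers.BgB) (X : R.carriers.Dom), ClusAbsConv S X (inputA_KP S E₀ cB g U X))
    (hsumB : ∀ g ∈ W, ∀ (U : R.carriers.BgB) (X : R.carriers.Dom), LevelSummable S X (inputB_KP S E₀ cB g U X))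
    (hKB : ∀ g ∈ W, ∀ (U : R.carriers.BgB) (X : R.carriers.Dom), ClusAbsConv S X (inputB_KP S E₀ cB g U X))
    (h : ∃ C₅, NE5 (outA_KP S E₀ cB) (outB_KP S E₀ cB) W κ θ' C₅) :
    ∃ C₅, NE5 (outA S E₀ cB) (outB S E₀ cB) W κ θ' C₅ := by
  obtain ⟨C₅, hC⟩ := h
  refine ⟨C₅, B13OutKPFormRecord.ne5_congr (fun g hg U X => ?_) (fun g hg U X => ?_) hC⟩
  · exact (outA_KP_eq_outA S E₀ cB (fun g hg => hT g (Set.mem_univ g)) hsumA hKA hg U X).symm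
  · exact (outB_KP_eq_outB S E₀ cB hsumB hKB hg U X).symm

end Summit.QuantumFields.BalabanUV.T4Continuum.B13KPStepOfRecord

end
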